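import Summits.HodgeConjecture.HodgeConjecture.Theorems.BoundaryReadoutAbsoluteReductionOfFacts
import Summits.HodgeConjecture.HodgeConjecture.Theorems.BoundaryReadoutPullbackAlgebraic
import Literature.AlgebraicGeometry.HodgeTheory.InvariantClassesFromTotalSpace
import Literature.AlgebraicGeometry.HodgeTheory.InvariantClassesFromTotalSpaceHolds
import Literature.AlgebraicGeometry.Motives.MixedHodgeStructureOfPair
import HarnessLib

/-!
# Route `BoundaryReadout` — crux `AbsoluteReduction` (stmt-HodgeConjecture-15945):
# the crux modulo TWO inputs (Voisin's flat spread ∧ partie fixe), the pull-back input discharged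

`Theorems/BoundaryReadoutAbsoluteReductionOfFacts.lean` reduced the crux `AbsoluteReduction`
(Voisin 2007, Prop. 1.2, absolute reading) to three inputs: Voisin's flat spread of an absolute class
over `ℚ̄` (`voisin2007_flatSpread_of_isAbsoluteHodgeClass`), Deligne's global invariant cycle theorem
(route item stmt-HodgeConjecture-16363 / Literature fact `deligne_globalInvariantCycles`) and the
pull-back of algebraic classes (route item stmt-HodgeConjecture-1071 / Fulton, Cor. 19.2). The third
input is now a THEOREM of the tree (`boundaryReadout_pullbackAlgebraic_proof`,
`fulton1998_map_mem_algebraicClasses_holds`, file `Theorems/BoundaryReadoutPullbackAlgebraic.lean`: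
deformation to the normal cone in coniveau form, constant lift, Zariski-local triviality of the
exceptional divisor), so the crux is here recorded modulo the two remaining inputs only, and — using
the LANDED Deligne-1968 half of the partie fixe (`deligne1968_invariantClass_fromTotalSpace_holds`,
Voisin II Thm. 4.18) and the tree's reduction
`deligne_globalInvariantCycles_of_deligne1968_of_cor3217` — modulo Voisin's flat spread and the
residual content of the partie fixe alone: a package `M` of Deligne's mixed Hodge structures on the
rational cohomology of complex varieties (`Motives.MixedHodgeStructureOfPair ℂ`, named fact
`existsDeligne`) satisfying Hodge II, Cor. 3.2.17 (`W_k Hᵏ(𝒳; ℚ) ⊆ Im i^*` for an open immersion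
`i : 𝒳 ⟶ 𝒳̄` into a smooth projective `𝒳̄`).

## Main results

* `absoluteReduction_of_flatSpread_of_deligne` — flat spread → item 16363 → `AbsoluteReduction`;
* `absoluteReduction_of_twoLiteratureFacts` — flat spread → `deligne_globalInvariantCycles` →
  `AbsoluteReduction`;
* `deligne_globalInvariantCycles_of_mixedHodgePackage` — (∃ `M` with Cor. 3.2.17) →
  `deligne_globalInvariantCycles` (Deligne 1968 half discharged by the tree);
* `absoluteReduction_of_flatSpread_of_mixedHodgePackage` — flat spread → (∃ `M` with Cor. 3.2.17) →
  `AbsoluteReduction`.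

All CONDITIONAL (the gate records `conditional-result`s; the item stays open until the two inputs
are discharged: the flat spread needs the algebraic de Rham dictionary, the package is Hodge II–III).

## References

* C. Voisin, *Hodge loci and absolute Hodge classes*, Compositio Math. 143 (2007) 945–958, §3,
  proof of Prop. 1.2. [Voisin2007HodgeLoci]
* P. Deligne, *Théorie de Hodge II*, Publ. Math. IHÉS 40 (1971), Thm. 4.1.1, Cor. 3.2.17.
  [DeligneHodgeII1971]
* C. Voisin, *Hodge Theory and Complex Algebraic Geometry II* (CUP 2003), Thm. 4.18, Prop. 4.23,
  Thm. 4.24. [VoisinHodgeII2003]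
* W. Fulton, *Intersection Theory*, 2nd ed. (1998), Cor. 19.2. [Fulton1998]
-/

-- every declaration of this problem lives in `Summit.HodgeConjecture.HodgeConjecture.…`
-- (single-problem summit: Problem = Summit), which `linter.dupNamespace` flags; set so that
-- stand-alone elaboration is warning-free.
set_option linter.dupNamespace false

noncomputable section

namespace Summit.HodgeConjecture.HodgeConjecture.Theorems

open CategoryTheory AlgebraicGeometry
open Literature.AlgebraicGeometry Literature.AlgebraicGeometry.Motives
open Literature.AlgebraicGeometry.HodgeTheory
open Summit.HodgeConjecture.HodgeConjecture.Theses

/-- **The crux modulo Voisin's flat spread and the partie fixe (route item).** `AbsoluteReduction`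
follows from the named fact `voisin2007_flatSpread_of_isAbsoluteHodgeClass` and Deligne's global
invariant cycle theorem (route item stmt-HodgeConjecture-16363); the pull-back of algebraic classes
(formerly the third input, route item stmt-HodgeConjecture-1071) is the tree theorem
`boundaryReadout_pullbackAlgebraic_proof`. CONDITIONAL on the two hypotheses.
[cite: Voisin2007HodgeLoci, §3, proof of Prop. 1.2] [cite: DeligneHodgeII1971, Théorème 4.1.1] -/
theorem absoluteReduction_of_flatSpread_of_deligne
    (hAS : voisin2007_flatSpread_of_isAbsoluteHodgeClass)
    (hD : LinearSystemTorelli.DeligneGlobalInvariantCycles) : BoundaryReadout.AbsoluteReduction :=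
  absoluteReduction_of_flatSpread hAS hD boundaryReadout_pullbackAlgebraic_proof

/-- **The crux modulo two named Literature facts.** `AbsoluteReduction` follows from Voisin's flat
spread (`voisin2007_flatSpread_of_isAbsoluteHodgeClass`) and Deligne's global invariant cycle theorem
(`deligne_globalInvariantCycles`, Hodge II Thm. 4.1.1); Fulton's pull-back theorem, the third fact of
`absoluteReduction_of_literatureFacts`, is discharged by `fulton1998_map_mem_algebraicClasses_holds`.
CONDITIONAL on the two facts. [cite: Voisin2007HodgeLoci, §3, proof of Prop. 1.2]
[cite: DeligneHodgeII1971, Théorème 4.1.1] -/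
theorem absoluteReduction_of_twoLiteratureFacts
    (hAS : voisin2007_flatSpread_of_isAbsoluteHodgeClass) (hD : deligne_globalInvariantCycles) :
    BoundaryReadout.AbsoluteReduction :=
  absoluteReduction_of_literatureFacts hAS hD fulton1998_map_mem_algebraicClasses_holds

/-- **The partie fixe modulo Deligne's mixed Hodge structures with Hodge II, Cor. 3.2.17.** The
Literature fact `deligne_globalInvariantCycles` follows from the existence of a package `M` of mixed
Hodge structures on the rational cohomology of pairs of complex varieties
(`Motives.MixedHodgeStructureOfPair ℂ`; named fact `existsDeligne`) satisfying Cor. 3.2.17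
(`W_k Hᵏ(𝒳; ℚ) ⊆ Im(i^* : Hᵏ(𝒳̄; ℚ) → Hᵏ(𝒳; ℚ))` for every open immersion `i : 𝒳 ⟶ 𝒳̄` into a
smooth projective `𝒳̄`): the Deligne-1968 half (Voisin II Thm. 4.18, pointwise) is the tree theorem
`deligne1968_invariantClass_fromTotalSpace_holds`, and the assembly is
`deligne_globalInvariantCycles_of_deligne1968_of_cor3217`. CONDITIONAL on the package.
[cite: DeligneHodgeII1971, Théorème 4.1.1 and Cor. 3.2.17] [cite: VoisinHodgeII2003, Thm. 4.18, Prop. 4.23, Thm. 4.24] -/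
theorem deligne_globalInvariantCycles_of_mixedHodgePackage
    (hM : ∃ M : MixedHodgeStructureOfPair ℂ,
      ∀ (𝒳 Xbar : SchemeOver ℂ) (i : 𝒳 ⟶ Xbar) (m : ℕ),
        IsProjectiveOver Xbar → SmoothOfRelativeDimension m Xbar.hom → IsOpenImmersion i.left →
        ∀ k : ℕ, (M.mhs (SchemePair.ofScheme 𝒳) k).W k ≤
          LinearMap.range (SchemePair.bettiCohomology.map (SchemePair.Hom.ofScheme i) k).hom) :
    deligne_globalInvariantCycles := by
  obtain ⟨M, h3217⟩ := hM
  exact deligne_globalInvariantCycles_of_deligne1968_of_cor3217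
    deligne1968_invariantClass_fromTotalSpace_holds M h3217

/-- **The crux modulo Voisin's flat spread and Deligne's mixed Hodge structures.** `AbsoluteReduction`
follows from the named fact `voisin2007_flatSpread_of_isAbsoluteHodgeClass` and the existence of a
package `M : Motives.MixedHodgeStructureOfPair ℂ` of mixed Hodge structures satisfying Hodge II,
Cor. 3.2.17 — the exact residual content of the partie fixe once its Deligne-1968 half
(`deligne1968_invariantClass_fromTotalSpace_holds`) and the pull-back of algebraic classes
(`fulton1998_map_mem_algebraicClasses_holds`) are theorems of the tree. CONDITIONAL on the two
hypotheses. [cite: Voisin2007HodgeLoci, §3, proof of Prop. 1.2]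
[cite: DeligneHodgeII1971, Théorème 4.1.1 and Cor. 3.2.17] -/
theorem absoluteReduction_of_flatSpread_of_mixedHodgePackage
    (hAS : voisin2007_flatSpread_of_isAbsoluteHodgeClass)
    (hM : ∃ M : MixedHodgeStructureOfPair ℂ,
      ∀ (𝒳 Xbar : SchemeOver ℂ) (i : 𝒳 ⟶ Xbar) (m : ℕ),
        IsProjectiveOver Xbar → SmoothOfRelativeDimension m Xbar.hom → IsOpenImmersion i.left →
        ∀ k : ℕ, (M.mhs (SchemePair.ofScheme 𝒳) k).W k ≤
          LinearMap.range (SchemePair.bettiCohomology.map (SchemePair.Hom.ofScheme i) k).hom) :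
    BoundaryReadout.AbsoluteReduction :=
  absoluteReduction_of_twoLiteratureFacts hAS (deligne_globalInvariantCycles_of_mixedHodgePackage hM)

end Summit.HodgeConjecture.HodgeConjecture.Theorems

end
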